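import Summits.QuantumFields.YangMills.Theorems.BalabanLadderIRAbstractBasinTermwise
import HarnessLib

/-!
# The term-wise symmetric class 𝔉 lies in EVERY basin — §4 the theorems (part 2 of 2; part 1 = `…Termwise.lean`: the family, dominance, decay)

AUTHORSHIP: written and kernel-checked by the critic seat ym-ir-crit-3 g0 (`pub/ym-ir/ym-ir-crit-3/PROBE-termwise-basin.lean` 44a81990b425,
PRELOAD-abstractBasin64.md §5.1–5.2, 2026-08-28T04:24Z; "landable as a Negative-side helper by any seat with propose rights"); landed verbatim modulo
namespace / `#print` removal by ideator ym-ir-idea-9 under RULING director-ym g9-№2 / №14(3).  The crux `BalabanLadder.IR` (stmt-QuantumFields-19354) is NOT proved.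
HONEST FRAMING: abstract bookkeeping about an explicit family of functions `ℕ⁴ → ℝ`; nothing here touches Yang–Mills content; the YM mass
gap (Clay) is NOT proved by any of this; R4 closes only `BalabanLadder.UV`.

𝔉 = finite sums of self-symmetric atoms `N · k₁^{e₁} · k₂^{e₂} · k₃^{e₃} · e^{−κ e₄}` (`N, k₁, k₂, k₃` positive integers, `κ` real; `e_k` the
elementary symmetric polynomials of the four sides).  THEOREM `termwise_defect_le`: if `boxDefect Z L₀ ≤ θ < 1/2` at ONE `L₀ ≥ 4` then for every
`L ≥ L₀`, `boxDefect Z L ≤ 2 · exp(ρ · log(θ/(1−θ)))` with `ρ = (L³⌊L/4⌋)/(L₀³⌊L₀/4⌋) ≥ 1`; COROLLARY `termwise_defect_double_le`: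
`boxDefect Z (2L₀) ≤ 2 (θ/(1−θ))^16` (`0 < θ < 1/2`); INSTANCE `termwise_eighth_to_epsStar`: `boxDefect Z L₀ ≤ 1/8 ⇒ boxDefect Z (2L₀) ≤ epsStar`
— so no 𝔉-datum can refute any `AbstractBasin θ ε` with `θ < 1/2`, `ε ≥ 2(θ/(1−θ))^16` (θ = 1/8: 2·7⁻¹⁶ ≈ 6·10⁻¹⁴ < epsStar = 2⁻²⁴);
the class hypotheses `IsAxisSymmetric / IsTracePositive / HasVolumeBounds` are not even used.  Mechanism: at the pure scale the
top atom has cross-section weight `W < 1/(1−θ) ≤ 2`, hence `W = 1`, hence it is the pure volume term `e^{−κ₁e₄}` (`eq_one_of_W_eq_one`);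
every other atom's log-ratio `F_j(L,⌊L/4⌋)` has non-negative entropy coefficients and the same volume rate, so
`(L₀³t₀)·F_j(L,t) ≤ (L³t)·F_j(L₀,t₀)` (`Fexp_scaled_le`) and `F_j(L₀,t₀) ≤ log(θ/(1−θ)) < 0` decays super-exponentially.
0 sorry; axioms {propext, Classical.choice, Quot.sound}.  Author: ym-ir-crit-3 g0 (refuter-ym-ir-crit-3-g0-0), 2026-08-28.
-/

set_option autoImplicit false

noncomputable section

open scoped BigOperators
open Finset
open Summit.QuantumFields.YangMills.Cruxes.IR.AspectBootstrap

namespace Summit.QuantumFields.YangMills.Cruxes.IR.BasinRung.Termwise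

variable {ι : Type*} [DecidableEq ι]

/-! ## §4 The theorem -/

/-- `one_sub_inv_sq_le` (crit-3 probe lemma; see the module docstring). -/
theorem one_sub_inv_sq_le {x : ℝ} (hx : 0 ≤ x) : 1 - 1 / (1 + x) ^ 2 ≤ 2 * x := by
  rw [sub_le_iff_le_add, ← sub_le_iff_le_add', le_div_iff₀ (by positivity)]
  nlinarith [sq_nonneg x, mul_nonneg hx (sq_nonneg x)]

/-- **𝔉 lies in every basin.**  If a term-wise symmetric datum is `θ`-pure (`θ < 1/2`) at ONE scale `L₀ ≥ 4`, then at every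
`L ≥ L₀` its defect is at most `2·exp(ρ·log(θ/(1−θ)))`, `ρ = (L³⌊L/4⌋)/(L₀³⌊L₀/4⌋)`. -/
theorem termwise_defect_le (s : Finset ι) (N k₁ k₂ k₃ : ι → ℕ) (κ : ι → ℝ)
    (hN : ∀ j, 1 ≤ N j) (hk₁ : ∀ j, 1 ≤ k₁ j) (hk₂ : ∀ j, 1 ≤ k₂ j) (hk₃ : ∀ j, 1 ≤ k₃ j)
    {θ : ℝ} (hθ : θ < 1 / 2) {L₀ : ℕ} (hL₀ : 4 ≤ L₀)
    (hδ : boxDefect (FSum s N k₁ k₂ k₃ κ) L₀ ≤ θ) {L : ℕ} (hL : L₀ ≤ L) :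
    boxDefect (FSum s N k₁ k₂ k₃ κ) L ≤
      2 * Real.exp (((L ^ 3 * (L / 4) : ℕ) : ℝ) / ((L₀ ^ 3 * (L₀ / 4) : ℕ) : ℝ) * Real.log (θ / (1 - θ))) := by
  -- Step 0: the sum is nonempty (an empty sum has defect 1 > θ).
  have hs : s.Nonempty := by
    by_contra h
    rw [Finset.not_nonempty_iff_eq_empty] at h
    simp [boxDefect, FSum, h] at hδ
    linarith
  set t₀ := L₀ / 4 with ht₀def
  set t := L / 4 with htdef
  have ht₀ : 1 ≤ t₀ := by omega
  have ht : t₀ ≤ t := Nat.div_le_div_right hL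
  have hL₀1 : 1 ≤ L₀ := by omega
  -- Step 1: dominance at L₀ with w = W(L₀), a = mu(L₀)^t₀.
  have hcube : ∀ L τ : ℕ, FSum s N k₁ k₂ k₃ κ L L L τ =
      ∑ j ∈ s, (W (N j) (k₁ j) (k₂ j) (k₃ j) L : ℝ) * mu (k₁ j) (k₂ j) (k₃ j) (κ j) L ^ τ := fun L τ => by
    unfold FSum; exact Finset.sum_congr rfl fun j _ => fterm_cube _ _ _ _ _ _ _
  have hδ' : 1 - (∑ j ∈ s, (W (N j) (k₁ j) (k₂ j) (k₃ j) L₀ : ℝ) * (mu (k₁ j) (k₂ j) (k₃ j) (κ j) L₀ ^ t₀) ^ 2) /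
      (∑ j ∈ s, (W (N j) (k₁ j) (k₂ j) (k₃ j) L₀ : ℝ) * mu (k₁ j) (k₂ j) (k₃ j) (κ j) L₀ ^ t₀) ^ 2 ≤ θ := by
    have h := hδ
    unfold boxDefect at h
    rw [hcube, hcube, ← ht₀def] at h
    have e : ∀ j, mu (k₁ j) (k₂ j) (k₃ j) (κ j) L₀ ^ (2 * t₀) = (mu (k₁ j) (k₂ j) (k₃ j) (κ j) L₀ ^ t₀) ^ 2 :=
      fun j => by rw [← pow_mul, Nat.mul_comm]
    simp only [e] at h
    exact h
  obtain ⟨j₁, hj₁, hw₁, hrest⟩ := dominant_of_defect_le hs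
    (fun j => (W (N j) (k₁ j) (k₂ j) (k₃ j) L₀ : ℝ)) (fun j => mu (k₁ j) (k₂ j) (k₃ j) (κ j) L₀ ^ t₀)
    (fun j _ => by exact_mod_cast one_le_W (hN j) (hk₁ j) (hk₂ j) (hk₃ j) L₀)
    (fun j _ => pow_pos (mu_pos (hk₁ j) (hk₂ j) (hk₃ j) (κ j) L₀) _) hθ hδ'
  -- Step 2: the dominant term is the pure volume term.
  have hW1 : W (N j₁) (k₁ j₁) (k₂ j₁) (k₃ j₁) L₀ = 1 := by
    have h1 := one_le_W (hN j₁) (hk₁ j₁) (hk₂ j₁) (hk₃ j₁) L₀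
    have h2 : (W (N j₁) (k₁ j₁) (k₂ j₁) (k₃ j₁) L₀ : ℝ) < 2 := hw₁
    have h3 : W (N j₁) (k₁ j₁) (k₂ j₁) (k₃ j₁) L₀ < 2 := by exact_mod_cast h2
    omega
  obtain ⟨eN, ek₁, ek₂, ek₃⟩ := eq_one_of_W_eq_one hL₀1 hW1
  set κ₁ := κ j₁ with hκ₁def
  have hpure : ∀ a b c d : ℕ, fterm (N j₁) (k₁ j₁) (k₂ j₁) (k₃ j₁) (κ j₁) a b c d =
      Real.exp (-(κ₁ * ((a * b * c * d : ℕ) : ℝ))) := fun a b c d => by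
    rw [eN, ek₁, ek₂, ek₃, fterm_pure]
  -- Step 3: the normalised remainder S(L,τ) and the factorisation Z(L,L,L,τ) = e^{-κ₁L³τ}(1 + S(L,τ)).
  set S : ℕ → ℕ → ℝ := fun L τ => ∑ j ∈ s.erase j₁, Real.exp (Fexp (N j) (k₁ j) (k₂ j) (k₃ j) (κ j) κ₁ L τ)
    with hSdef
  have hS0 : ∀ L τ, 0 ≤ S L τ := fun L τ => Finset.sum_nonneg fun j _ => (Real.exp_pos _).le
  have hZ : ∀ L τ : ℕ, FSum s N k₁ k₂ k₃ κ L L L τ = Real.exp (-(κ₁ * ((L ^ 3 * τ : ℕ) : ℝ))) * (1 + S L τ) := by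
    intro L τ
    unfold FSum
    rw [← Finset.add_sum_erase s _ hj₁, hpure, hSdef]
    simp only
    rw [mul_add, mul_one, Finset.mul_sum]
    congr 1
    · congr 1; congr 1; congr 1; push_cast; ring
    · refine Finset.sum_congr rfl fun j _ => ?_
      rw [fterm_cube_eq_exp (hN j) (hk₁ j) (hk₂ j) (hk₃ j) (κ j) κ₁, mul_comm]
  -- Step 4: S(L₀,t₀) ≤ X := θ/(1-θ).
  have hθ0 : 0 ≤ θ := by
    -- defect of this family is ≥ 0? we only need: X ≥ S ≥ 0 below; derive from hrest instead.
    have h0 : 0 ≤ ∑ j ∈ s.erase j₁, (W (N j) (k₁ j) (k₂ j) (k₃ j) L₀ : ℝ) * mu (k₁ j) (k₂ j) (k₃ j) (κ j) L₀ ^ t₀ :=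
      Finset.sum_nonneg fun j _ => mul_nonneg (by positivity) (pow_pos (mu_pos (hk₁ j) (hk₂ j) (hk₃ j) (κ j) L₀) _).le
    have ha₁ : 0 < mu (k₁ j₁) (k₂ j₁) (k₃ j₁) (κ j₁) L₀ ^ t₀ := pow_pos (mu_pos (hk₁ j₁) (hk₂ j₁) (hk₃ j₁) _ L₀) _
    have h1 : 0 ≤ θ / (1 - θ) := by
      by_contra hc; push Not at hc
      have : θ / (1 - θ) * mu (k₁ j₁) (k₂ j₁) (k₃ j₁) (κ j₁) L₀ ^ t₀ < 0 := mul_neg_of_neg_of_pos hc ha₁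
      linarith [hrest]
    have hθ1 : 0 < 1 - θ := by linarith
    by_contra hc; push Not at hc
    have : θ / (1 - θ) < 0 := div_neg_of_neg_of_pos hc hθ1
    linarith
  have hθ1 : 0 < 1 - θ := by linarith
  set X := θ / (1 - θ) with hXdef
  have hX0 : 0 ≤ X := div_nonneg hθ0 hθ1.le
  have hSX : S L₀ t₀ ≤ X := by
    -- hrest : ∑_{erase} W mu^t₀ ≤ X * mu₁^t₀ ; and W mu^t₀ = fterm(L₀,L₀,L₀,t₀) = exp F * exp(-κ₁V₀), mu₁^t₀ = exp(-κ₁ V₀)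
    have hV : Real.exp (-(κ₁ * ((L₀ ^ 3 * t₀ : ℕ) : ℝ))) = mu (k₁ j₁) (k₂ j₁) (k₃ j₁) (κ j₁) L₀ ^ t₀ := by
      have h := fterm_cube (N j₁) (k₁ j₁) (k₂ j₁) (k₃ j₁) (κ j₁) L₀ t₀
      rw [hW1, hpure] at h
      push_cast at h
      rw [one_mul] at h
      rw [← h]; congr 1; push_cast; ring
    have hpos : 0 < Real.exp (-(κ₁ * ((L₀ ^ 3 * t₀ : ℕ) : ℝ))) := Real.exp_pos _
    have h2 : S L₀ t₀ * Real.exp (-(κ₁ * ((L₀ ^ 3 * t₀ : ℕ) : ℝ))) ≤ X * Real.exp (-(κ₁ * ((L₀ ^ 3 * t₀ : ℕ) : ℝ))) := by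
      rw [hSdef]
      simp only
      rw [Finset.sum_mul]
      have h3 : ∑ j ∈ s.erase j₁, Real.exp (Fexp (N j) (k₁ j) (k₂ j) (k₃ j) (κ j) κ₁ L₀ t₀) *
          Real.exp (-(κ₁ * ((L₀ ^ 3 * t₀ : ℕ) : ℝ))) =
          ∑ j ∈ s.erase j₁, (W (N j) (k₁ j) (k₂ j) (k₃ j) L₀ : ℝ) * mu (k₁ j) (k₂ j) (k₃ j) (κ j) L₀ ^ t₀ := by
        refine Finset.sum_congr rfl fun j _ => ?_
        rw [← fterm_cube_eq_exp (hN j) (hk₁ j) (hk₂ j) (hk₃ j), fterm_cube]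
      rw [h3, hV]
      exact hrest
    exact le_of_mul_le_mul_right h2 hpos
  -- Step 5: each remainder term at (L,t) is bounded by its value at (L₀,t₀) times X^(ρ-1).
  set ρ : ℝ := ((L ^ 3 * t : ℕ) : ℝ) / ((L₀ ^ 3 * t₀ : ℕ) : ℝ) with hρdef
  have hV₀ : (0 : ℝ) < ((L₀ ^ 3 * t₀ : ℕ) : ℝ) := by
    have : 0 < L₀ ^ 3 * t₀ := Nat.mul_pos (Nat.pow_pos (by omega)) (by omega)
    exact_mod_cast this
  have hρ1 : 1 ≤ ρ := by
    rw [hρdef, le_div_iff₀ hV₀, one_mul]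
    have : L₀ ^ 3 * t₀ ≤ L ^ 3 * t := Nat.mul_le_mul (Nat.pow_le_pow_left hL 3) ht
    exact_mod_cast this
  -- Case split: if the remainder is empty the defect is 0.
  by_cases hem : (s.erase j₁) = ∅
  · have hS : ∀ L τ, S L τ = 0 := fun L τ => by rw [hSdef]; simp [hem]
    have hdef : boxDefect (FSum s N k₁ k₂ k₃ κ) L = 0 := by
      unfold boxDefect
      rw [hZ, hZ, hS, hS, add_zero, mul_one, mul_one]
      have e : Real.exp (-(κ₁ * ((L ^ 3 * (2 * (L / 4)) : ℕ) : ℝ))) = Real.exp (-(κ₁ * ((L ^ 3 * (L / 4) : ℕ) : ℝ))) ^ 2 := by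
        rw [← Real.exp_nat_mul]; congr 1; push_cast; ring
      rw [e, div_self (pow_ne_zero 2 (Real.exp_pos _).ne')]
      ring
    rw [hdef]
    positivity
  -- Nonempty remainder: X > 0 and every F_j(L₀,t₀) ≤ log X.
  have hne : (s.erase j₁).Nonempty := Finset.nonempty_iff_ne_empty.2 hem
  have hXpos : 0 < X := by
    obtain ⟨j, hj⟩ := hne
    have h1 : Real.exp (Fexp (N j) (k₁ j) (k₂ j) (k₃ j) (κ j) κ₁ L₀ t₀) ≤ S L₀ t₀ := by
      rw [hSdef]
      exact Finset.single_le_sum (f := fun j => Real.exp (Fexp (N j) (k₁ j) (k₂ j) (k₃ j) (κ j) κ₁ L₀ t₀))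
        (fun i _ => (Real.exp_pos _).le) hj
    linarith [Real.exp_pos (Fexp (N j) (k₁ j) (k₂ j) (k₃ j) (κ j) κ₁ L₀ t₀)]
  have hFle : ∀ j ∈ s.erase j₁, Fexp (N j) (k₁ j) (k₂ j) (k₃ j) (κ j) κ₁ L₀ t₀ ≤ Real.log X := by
    intro j hj
    have h1 : Real.exp (Fexp (N j) (k₁ j) (k₂ j) (k₃ j) (κ j) κ₁ L₀ t₀) ≤ X := by
      refine le_trans ?_ hSX
      rw [hSdef]
      exact Finset.single_le_sum (f := fun j => Real.exp (Fexp (N j) (k₁ j) (k₂ j) (k₃ j) (κ j) κ₁ L₀ t₀))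
        (fun i _ => (Real.exp_pos _).le) hj
    exact (Real.le_log_iff_exp_le hXpos).2 h1
  have hterm : ∀ j ∈ s.erase j₁, Real.exp (Fexp (N j) (k₁ j) (k₂ j) (k₃ j) (κ j) κ₁ L t) ≤
      Real.exp (Fexp (N j) (k₁ j) (k₂ j) (k₃ j) (κ j) κ₁ L₀ t₀) * Real.exp ((ρ - 1) * Real.log X) := by
    intro j hj
    rw [← Real.exp_add]
    apply Real.exp_le_exp.2
    have hsc := Fexp_scaled_le (hN j) (hk₁ j) (hk₂ j) (hk₃ j) (κ j) κ₁ hL₀1 hL ht₀ ht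
    -- F(L,t) ≤ ρ F(L₀,t₀) ≤ F(L₀,t₀) + (ρ-1) log X
    have h1 : Fexp (N j) (k₁ j) (k₂ j) (k₃ j) (κ j) κ₁ L t ≤ ρ * Fexp (N j) (k₁ j) (k₂ j) (k₃ j) (κ j) κ₁ L₀ t₀ := by
      rw [hρdef, div_mul_eq_mul_div, le_div_iff₀ hV₀, mul_comm]
      linarith [hsc]
    have h2 := hFle j hj
    nlinarith [h1, h2, hρ1]
  have hSL : S L t ≤ Real.exp (ρ * Real.log X) := by
    have h1 : S L t ≤ S L₀ t₀ * Real.exp ((ρ - 1) * Real.log X) := by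
      rw [hSdef]
      simp only
      rw [Finset.sum_mul]
      exact Finset.sum_le_sum hterm
    have h2 : S L₀ t₀ * Real.exp ((ρ - 1) * Real.log X) ≤ X * Real.exp ((ρ - 1) * Real.log X) :=
      mul_le_mul_of_nonneg_right hSX (Real.exp_pos _).le
    have h3 : X * Real.exp ((ρ - 1) * Real.log X) = Real.exp (ρ * Real.log X) := by
      rw [show ρ * Real.log X = Real.log X + (ρ - 1) * Real.log X by ring, Real.exp_add, Real.exp_log hXpos]
    linarith [h1, h2, h3.le]
  -- Step 6: the defect at L.
  have hdef : boxDefect (FSum s N k₁ k₂ k₃ κ) L = 1 - (1 + S L (2 * t)) / (1 + S L t) ^ 2 := by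
    unfold boxDefect
    rw [hZ, hZ]
    have e : Real.exp (-(κ₁ * ((L ^ 3 * (2 * (L / 4)) : ℕ) : ℝ))) = Real.exp (-(κ₁ * ((L ^ 3 * (L / 4) : ℕ) : ℝ))) ^ 2 := by
      rw [← Real.exp_nat_mul]; congr 1; push_cast; ring
    rw [e, mul_pow, mul_div_mul_left _ _ (pow_ne_zero 2 (Real.exp_pos _).ne')]
  rw [hdef]
  have hS1 := hS0 L t
  have hS2 := hS0 L (2 * t)
  calc 1 - (1 + S L (2 * t)) / (1 + S L t) ^ 2 ≤ 1 - 1 / (1 + S L t) ^ 2 := by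
        gcongr; linarith
    _ ≤ 2 * S L t := one_sub_inv_sq_le hS1
    _ ≤ 2 * Real.exp (ρ * Real.log X) := by linarith [hSL]


/-- **Corollary (one doubling).**  `θ`-purity at `L₀ ≥ 4` (`0 < θ < 1/2`) gives defect `≤ 2(θ/(1−θ))¹⁶` at `2L₀`. -/
theorem termwise_defect_double_le (s : Finset ι) (N k₁ k₂ k₃ : ι → ℕ) (κ : ι → ℝ)
    (hN : ∀ j, 1 ≤ N j) (hk₁ : ∀ j, 1 ≤ k₁ j) (hk₂ : ∀ j, 1 ≤ k₂ j) (hk₃ : ∀ j, 1 ≤ k₃ j)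
    {θ : ℝ} (hθ0 : 0 < θ) (hθ : θ < 1 / 2) {L₀ : ℕ} (hL₀ : 4 ≤ L₀)
    (hδ : boxDefect (FSum s N k₁ k₂ k₃ κ) L₀ ≤ θ) :
    boxDefect (FSum s N k₁ k₂ k₃ κ) (2 * L₀) ≤ 2 * (θ / (1 - θ)) ^ 16 := by
  have h := termwise_defect_le s N k₁ k₂ k₃ κ hN hk₁ hk₂ hk₃ hθ hL₀ hδ (L := 2 * L₀) (by omega)
  refine le_trans h ?_
  have hθ1 : 0 < 1 - θ := by linarith
  have hXpos : 0 < θ / (1 - θ) := div_pos hθ0 hθ1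
  have hX1 : θ / (1 - θ) < 1 := by rw [div_lt_one hθ1]; linarith
  have hlog : Real.log (θ / (1 - θ)) < 0 := Real.log_neg hXpos hX1
  have hV₀ : (0 : ℝ) < ((L₀ ^ 3 * (L₀ / 4) : ℕ) : ℝ) := by
    have : 0 < L₀ ^ 3 * (L₀ / 4) := Nat.mul_pos (Nat.pow_pos (by omega)) (by omega)
    exact_mod_cast this
  have hρ : (16 : ℝ) ≤ (((2 * L₀) ^ 3 * (2 * L₀ / 4) : ℕ) : ℝ) / ((L₀ ^ 3 * (L₀ / 4) : ℕ) : ℝ) := by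
    rw [le_div_iff₀ hV₀]
    have h1 : 2 * (L₀ / 4) ≤ 2 * L₀ / 4 := by omega
    have h2 : 16 * (L₀ ^ 3 * (L₀ / 4)) ≤ (2 * L₀) ^ 3 * (2 * L₀ / 4) := by
      calc 16 * (L₀ ^ 3 * (L₀ / 4)) = (2 * L₀) ^ 3 * (2 * (L₀ / 4)) := by ring
        _ ≤ (2 * L₀) ^ 3 * (2 * L₀ / 4) := Nat.mul_le_mul_left _ h1
    exact_mod_cast h2
  have h4 : Real.exp ((((2 * L₀) ^ 3 * (2 * L₀ / 4) : ℕ) : ℝ) / ((L₀ ^ 3 * (L₀ / 4) : ℕ) : ℝ) *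
      Real.log (θ / (1 - θ))) ≤ Real.exp (16 * Real.log (θ / (1 - θ))) :=
    Real.exp_le_exp.2 (by nlinarith [hρ, hlog])
  have h5 : Real.exp (16 * Real.log (θ / (1 - θ))) = (θ / (1 - θ)) ^ 16 := by
    rw [show (16 : ℝ) = ((16 : ℕ) : ℝ) by norm_num, Real.exp_nat_mul, Real.exp_log hXpos]
  linarith [h4, h5]

open Summit.QuantumFields.YangMills.Cruxes.IR.BasinRung (epsStar) in
/-- **The retargeted stub's class 𝔉 is closed in one doubling:** `1/8`-purity at `L₀ ≥ 4` ⇒ `epsStar`-purity at `2L₀`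
(`2·7⁻¹⁶ ≈ 6·10⁻¹⁴ ≤ 2⁻²⁴`).  No counterexample to `AbstractBasin (1/8) (2⁻⁶)` (or to `(1/8) → epsStar`) lives in 𝔉. -/
theorem termwise_eighth_to_epsStar (s : Finset ι) (N k₁ k₂ k₃ : ι → ℕ) (κ : ι → ℝ)
    (hN : ∀ j, 1 ≤ N j) (hk₁ : ∀ j, 1 ≤ k₁ j) (hk₂ : ∀ j, 1 ≤ k₂ j) (hk₃ : ∀ j, 1 ≤ k₃ j)
    {L₀ : ℕ} (hL₀ : 4 ≤ L₀) (hδ : boxDefect (FSum s N k₁ k₂ k₃ κ) L₀ ≤ 1 / 8) :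
    boxDefect (FSum s N k₁ k₂ k₃ κ) (2 * L₀) ≤ epsStar := by
  have h := termwise_defect_double_le s N k₁ k₂ k₃ κ hN hk₁ hk₂ hk₃ (by norm_num) (by norm_num) hL₀ hδ
  refine le_trans h ?_
  unfold epsStar
  rw [max_eq_left (by norm_num)]
  norm_num


end Summit.QuantumFields.YangMills.Cruxes.IR.BasinRung.Termwise
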